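import Mathlib
import Summits.Ventures.PercRepro2.Defs
import Summits.Ventures.PercRepro2.Graph
import Summits.Ventures.PercRepro2.OneColourSwitch
import Summits.Ventures.PercRepro2.M9NoPocketDefs
import Summits.Ventures.PercRepro2.M9PocketProdPoint
import Summits.Ventures.PercRepro2.M9PocketProdWorlds
import Summits.Ventures.PercRepro2.M9PocketProdMono
import Summits.Ventures.PercRepro2.M9PocketUnitFibreSumT
import Summits.Ventures.PercRepro2.M9PocketProdPointT
import Summits.Ventures.PercRepro2.M9PocketProdWorldsT
import Summits.Ventures.PercRepro2.M9PocketProdMonoT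

/-!
# [`T`-edge chain] `σ_pq` is monotone on the product fibre (blind cell PercRepro2, p3 g40,
2026-08-29; `proofs/P3-POCKETRK.md` §10⁗ (f): the linking free blocks, step (P1))

On the product fibre of a skeleton, `p ~_Y q` grows with the index (`conn_prod_mono_T`) and
`p ~_W q` shrinks with it: a `W`-path from `p` at the larger index never enters a switched
block (its attachment edges are `Y` there) nor `r, s` (`Sep`), its free edges are closed at
the smaller index too and its other edges are fixed or touch a block switched at both indices —
the argument of `cluster_compl_d_prod_anti_T` with `p` in place of `d`
(`conn_compl_prod_anti_T`).  Hence `σ_pq(φ S) ≤ σ_pq(φ S')` for `S ⊆ S'`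
(`sigma_pq_prod_mono_T`): switching a block to the `W`-side, in particular a LINKING one, can
only raise `σ_pq` — the termwise half of the comparison `A + B ≤ BAD` of §10⁗ (f).
`T`-edges arbitrary.  Own work; std axioms.
-/

namespace Summit.Ventures.PercRepro2

namespace NoPocket

open Finset Classical OneColourSwitch SideSwitch

variable {V : Type*} {E : Type*} {ends : E → Sym2 V} {p q r s d : V} {ρ : Config E}
  {𝔉 : Finset (Finset V)} {R : Finset E}

section SigmaMono

variable (hdr : d ≠ r) (hds : d ≠ s) (hrs : within ends ({r, s} : Set V) = ∅)
  (hM : d ∉ M2 ends r s ρ)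
  (hsep : sep2 ends p q r s ρ) (hD : DOne ends r s d ρ) (hK : d ∈ K2 ends r s ρ)
  (hB : ∀ x ∈ M2 (endsD ends d) r s ρ, x = r ∨ x = s)
  (hR : ∀ e, e ∈ R ↔ e ∉ touches ends (cluster ends ρ d ∪ K2 (endsD ends d) r s ρ ∪
    M2 (endsD ends d) r s ρ))
  (h𝔉K : ∀ C ∈ 𝔉, (↑C : Set V) ⊆ K2 (endsD ends d) r s ρ)
  (h𝔉r : ∀ C ∈ 𝔉, r ∉ C) (h𝔉s : ∀ C ∈ 𝔉, s ∉ C)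
  (h𝔉cl : ∀ C ∈ 𝔉, ClosedIn (endsD ends d) (sided (endsD ends d) r s ρ) (↑C : Set V))
  (h𝔉d : ∀ C ∈ 𝔉, ∀ e y, y ∈ C → ends e ≠ s(d, y))
  (h𝔉pk : ∀ C ∈ 𝔉, ∀ e x y, ends e = s(x, y) → x ∈ C → y ∈ cluster ends ρ d →
    y ∈ C ∨ y = r ∨ y = s)
  (hp : p ≠ d) (hq : q ≠ d)
  {S S' : Finset ({C // C ∈ 𝔉} ⊕ {e // e ∈ R})} (hSS : S ⊆ S')

include hdr hds hrs hM hsep hD hK hB hR h𝔉K h𝔉r h𝔉s h𝔉cl h𝔉d h𝔉pk hp hq hSS in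
/-- **`p ~_W q` is antitone in the index**: a `W`-path from `p` at the larger index never enters
a switched block or `r, s`; its free edges are closed at the smaller index too, its other edges
are fixed or touch a block switched at both indices. -/
lemma conn_compl_prod_anti_T
    (h : Conn ends (OneColourSwitch.compl (flipTouch (endsD ends d)
      {x : V | ∃ c : {C // C ∈ 𝔉}, Sum.inl c ∈ S' ∧ x ∈ c.1}
      (fun e => if h : e ∈ R then decide (Sum.inr ⟨e, h⟩ ∈ S') else ρ e))) p q) :
    Conn ends (OneColourSwitch.compl (flipTouch (endsD ends d)
      {x : V | ∃ c : {C // C ∈ 𝔉}, Sum.inl c ∈ S ∧ x ∈ c.1}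
      (fun e => if h : e ∈ R then decide (Sum.inr ⟨e, h⟩ ∈ S) else ρ e))) p q := by
  set Sw := {x : V | ∃ c : {C // C ∈ 𝔉}, Sum.inl c ∈ S ∧ x ∈ c.1} with hSw
  set Sw' := {x : V | ∃ c : {C // C ∈ 𝔉}, Sum.inl c ∈ S' ∧ x ∈ c.1} with hSw'
  set ω := flipTouch (endsD ends d) Sw
    (fun e => if h : e ∈ R then decide (Sum.inr ⟨e, h⟩ ∈ S) else ρ e) with hω
  set ω' := flipTouch (endsD ends d) Sw'
    (fun e => if h : e ∈ R then decide (Sum.inr ⟨e, h⟩ ∈ S') else ρ e) with hω'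
  have hSwK' := switched_subset_K2 (ρ := ρ) (r := r) (s := s) (d := d) (R := R) h𝔉K S'
  have hsep' := sep2_prod_T hdr hds hrs hM hsep hD hK hB hR h𝔉K h𝔉r h𝔉s h𝔉cl h𝔉d h𝔉pk S' hp hq
  have hpM' : p ∉ M2 ends r s ω' := (not_mem_M2_of_sep2 hsep').1
  have hpK : p ∉ K2 ends r s ρ := (not_mem_K2_of_sep2 hsep).1
  have hpr : p ≠ r := by rintro rfl; exact hpK (r_mem_K2 p s ρ)
  have hps : p ≠ s := by rintro rfl; exact hpK (s_mem_K2 r p ρ)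
  have key : q ∈ {z | Conn ends (OneColourSwitch.compl ω') p z ∧
      Conn ends (OneColourSwitch.compl ω) p z ∧ z ∉ Sw' ∧ z ≠ r ∧ z ≠ s} := by
    refine mem_of_conn_of_closed ?_ ⟨conn_refl _ _ _, conn_refl _ _ _,
      fun h' => hpK (K2_endsD_subset_K2 ρ (hSwK' h')), hpr, hps⟩ h
    rintro a ⟨hac', hac, haSw', har, has⟩ b hab
    obtain ⟨hne, e, he, hends⟩ := openGraph_adj.1 hab
    have hac'' : Conn ends (OneColourSwitch.compl ω') p b :=
      conn_trans hac' (conn_of_openAdj ⟨e, he, hends⟩)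
    -- `b` is not `r` or `s` (`p` is not `W`-reached from `{r, s}`)
    have hbrs : ¬ (b = r ∨ b = s) := by
      intro hb
      apply hpM'
      rcases hb with rfl | rfl
      · exact mem_M2_iff.2 (Or.inl (conn_symm hac''))
      · exact mem_M2_iff.2 (Or.inr (conn_symm hac''))
    have he' : ω' e = false := by
      simp only [OneColourSwitch.compl, Bool.not_eq_true'] at he; exact he
    -- `b` is not in a block of `S'`: the edge would be flipped, hence `Y` at `ρ`, which is
    -- impossible from `a`
    have hbSw' : b ∉ Sw' := by
      rintro ⟨c, hcS', hbc⟩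
      have hbK : b ∈ K2 (endsD ends d) r s ρ := hSwK' ⟨c, hcS', hbc⟩
      have hbd : b ≠ d := by rintro rfl; exact not_mem_K2_endsD hdr hds ρ hbK
      have had : a ≠ d := by rintro rfl; exact h𝔉d c.1 c.2 e b hbc hends
      have hde : d ∉ ends e := notMem_of_ends_ne hends had hbd
      have hnR : e ∉ R := fun h' => (hR e).1 h' ⟨b, Or.inl (Or.inr hbK), a, by rw [hends, Sym2.eq_swap]⟩
      have ht' : e ∈ touches (endsD ends d) Sw' :=
        ⟨b, ⟨c, hcS', hbc⟩, a, by rw [endsD_of_notMem hde, hends, Sym2.eq_swap]⟩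
      rw [hω', prod_eq_of_touches S' hnR ht'] at he'
      have hρe : ρ e = true := by
        cases h' : ρ e
        · rw [h'] at he'; exact absurd he' (by decide)
        · rfl
      -- a `Y` edge at `ρ` from `a ∉ Sw' ∪ {r, s}` into the block `c`
      by_cases haK : a ∈ K2 (endsD ends d) r s ρ
      · exact haSw' ⟨c, hcS', Finset.mem_coe.1 (h𝔉cl c.1 c.2 e b a
          (by rw [endsD_of_notMem hde, hends, Sym2.eq_swap]) (Finset.mem_coe.2 hbc)
          ⟨Or.inl haK, har, has⟩)⟩
      · exact haK (mem_K2_of_open hbK hρe (by rw [endsD_of_notMem hde, hends, Sym2.eq_swap]))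
    refine ⟨hac'', conn_trans hac (conn_of_openAdj ⟨e, ?_, hends⟩), hbSw',
      fun h => hbrs (Or.inl h), fun h => hbrs (Or.inr h)⟩
    -- the colour at `ω`: a free edge, an edge at a block of `S`, or a fixed edge
    simp only [OneColourSwitch.compl, Bool.not_eq_true']
    by_cases heR : e ∈ R
    · have hnt := notMem_touches_switched_of_mem_R hdr hds hR h𝔉K S heR
      have hnt' := notMem_touches_switched_of_mem_R hdr hds hR h𝔉K S' heR
      rw [hω', prod_eq_of_mem_R S' heR hnt'] at he'
      rw [hω, prod_eq_of_mem_R S heR hnt]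
      simp only [decide_eq_false_iff_not] at he' ⊢
      exact fun h => he' (hSS h)
    · have hnt' : e ∉ touches (endsD ends d) Sw' := by
        rintro ⟨z, hz, w, hzw⟩
        have hzK := hSwK' hz
        have hzd : z ≠ d := by rintro rfl; exact not_mem_K2_endsD hdr hds ρ hzK
        have hde : d ∉ ends e := by
          intro hde
          rw [endsD_of_mem hde, Sym2.eq_iff] at hzw
          rcases hzw with ⟨h1, _⟩ | ⟨_, h1⟩ <;> exact hzd h1.symm
        rw [endsD_of_notMem hde, hends, Sym2.eq_iff] at hzw
        rcases hzw with ⟨h1, _⟩ | ⟨_, h1⟩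
        · exact haSw' (h1 ▸ hz)
        · exact hbSw' (h1 ▸ hz)
      have hnt : e ∉ touches (endsD ends d) Sw := fun h =>
        hnt' (by
          obtain ⟨z, hz, w, hzw⟩ := h
          exact ⟨z, ⟨hz.choose, hSS hz.choose_spec.1, hz.choose_spec.2⟩, w, hzw⟩)
      rw [hω', prod_eq_fixed S' heR hnt'] at he'
      rw [hω, prod_eq_fixed S heR hnt]
      exact he'
  exact key.2.1

include hdr hds hrs hM hsep hD hK hB hR h𝔉K h𝔉r h𝔉s h𝔉cl h𝔉d h𝔉pk hp hq hSS in
/-- **`σ_pq` is monotone on the product fibre**: `p ~_Y q` grows and `p ~_W q` shrinks with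
the index. -/
lemma sigma_pq_prod_mono_T :
    sigma ends (flipTouch (endsD ends d)
      {x : V | ∃ c : {C // C ∈ 𝔉}, Sum.inl c ∈ S ∧ x ∈ c.1}
      (fun e => if h : e ∈ R then decide (Sum.inr ⟨e, h⟩ ∈ S) else ρ e)) p q ≤
    sigma ends (flipTouch (endsD ends d)
      {x : V | ∃ c : {C // C ∈ 𝔉}, Sum.inl c ∈ S' ∧ x ∈ c.1}
      (fun e => if h : e ∈ R then decide (Sum.inr ⟨e, h⟩ ∈ S') else ρ e)) p q := by
  have hY := conn_prod_mono_T hdr hds hrs hM hsep hD hK hB hR h𝔉K h𝔉r h𝔉s h𝔉cl h𝔉d h𝔉pk S hSS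
    (p := p) (q := q)
  have hW := conn_compl_prod_anti_T hdr hds hrs hM hsep hD hK hB hR h𝔉K h𝔉r h𝔉s h𝔉cl h𝔉d h𝔉pk
    hp hq hSS
  set ω := flipTouch (endsD ends d) {x : V | ∃ c : {C // C ∈ 𝔉}, Sum.inl c ∈ S ∧ x ∈ c.1}
    (fun e => if h : e ∈ R then decide (Sum.inr ⟨e, h⟩ ∈ S) else ρ e) with hω
  set ω' := flipTouch (endsD ends d) {x : V | ∃ c : {C // C ∈ 𝔉}, Sum.inl c ∈ S' ∧ x ∈ c.1}
    (fun e => if h : e ∈ R then decide (Sum.inr ⟨e, h⟩ ∈ S') else ρ e) with hω'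
  unfold sigma
  by_cases h1 : Conn ends ω p q
  · rw [if_pos h1, if_pos (hY h1)]
    by_cases h4 : Conn ends (OneColourSwitch.compl ω') p q
    · rw [if_pos h4, if_pos (hW h4)]
    · rw [if_neg h4]
      split_ifs <;> norm_num
  · rw [if_neg h1]
    by_cases h4 : Conn ends (OneColourSwitch.compl ω') p q
    · rw [if_pos h4, if_pos (hW h4)]
      split_ifs <;> norm_num
    · rw [if_neg h4]
      split_ifs <;> norm_num

end SigmaMono

end NoPocket

end Summit.Ventures.PercRepro2
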